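import Summits.QuantumFields.BalabanUV.T4Continuum.Spine.NE3.LandauCorrectionSupB8Curved
import HarnessLib

/-!
# NE7LandauB8CorrectionRow — (R-C8) DISCHARGED AT A CURVED BACKGROUND OF THE CLASS, IN THE END's OWN VOLUME CURRENCY `c_RE`: the (1.38)-LANDAU CORRECTION of an
# ARBITRARY skew periodic 1-form `Z` by a block-mean-zero gauge `c ∈ N(Q′(W))` exists (row NE3) AND obeys the sup rows `‖Δ_W c‖ ≤ c_RE·‖covDiv_W Z‖_∞`,
# `‖D_W c‖ ≤ 36d·F·M·c_RE·‖covDiv_W Z‖_∞`, `‖c‖ ≤ 36d·F²·M²·c_RE·‖covDiv_W Z‖_∞` (`F = frameC + d`, `M = L^{j+1}`, `c_RE = 1 + 2·card n·(64d²N)^d + 27(card n)³512^dN^d`)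
# (file 110 of the curved (APE), F180)

Cell `pub-balaban`, rung (B)+1 sub-cell t4, lineage `b2b-balaban-t4-ne7-p1` (CRUX PROVER NE7 #1 = OWNER of row NE7), generation 84; memo
`t4/b2b-balaban-t4-ne7-p1-g84/SCALAR-ROWS.md`.  Over row NE3's census R39∕R40 files BY NAME (pure composition): `LandauProjectionB8.exists_landauB8_correction`
(existence for every `Z`), `LandauCorrectionSupB8Flat.sum_hsR_covDiv_add_covLapSite_eq_zero_of_isLandauB8` (Euler–Lagrange form),
`LandauProjectionSupCurvedUniform.hRW_of_radii` ((HR_W): the `ℓ^∞` bound of the (1.38)-projection, constant `c_RE`), `SupRegularityCurvedUniform.supRegularity_uniform`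
((H0_W): sup regularity of `Δ_W` on `N(Q′(W))`, constants `36dF·M`, `36dF²·M²`), `NE3FluxGradientDictionary.norm_Ad_hol_sub_hol_le_of_fluxGrad` (`x₁ = 2g`).
WHY.  The END OF RECORD after gen 83 (`NE7ApeCurvedRepRoadBLandauB8End`, F178) displays THREE sup rows at the curved background; its third, (R-C8) `hRC`, is the sup size of
the (1.38)-Landau correction of a GENERAL skew periodic `Z` — and row NE3 proved exactly this mechanism for ITS special `Z` (the lift of the solved datum,
`LandauCorrectionSupB8Curved.landauCorrectionSupB8_curved`) from two regularity radii of `W` with the volume-dependent constant `c_RE` that the END's E′ regime lines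
ALREADY carry (`hcRE`, `hreg₁₋₃`, `hline`).  This file ports the composition to a general `Z`: (R-C8) is thereby a THEOREM in the END's own currency
(`C_b = 36d·F²·M²·c_RE`), and the END rests on (KL-B) + (R-H8) (sequel F181).
WHAT ([folklore]; 0 def, 0 sorry).  §1 **`landauB8Correction_row`** (plaquette-gradient radius `x₁`); §2 **`landauB8Correction_row_of_fluxGrad`** (the END's letters: flux-gradient
radius `g_W`, `x ≤ 1∕4`, the two level-free lines `23040d⁴F²M²x ≤ 1`, `11520d⁴F³M³(2g_W) ≤ 1`); §3 **`landauB8CorrectionLetter_of_fluxGrad`** — literally the END's binder `hRC`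
with `C_b := 36d·F²·M²·c_RE`.
HONEST FRAMING (page 1): composition of row NE3's kernel theorems; the constant is VOLUME-DEPENDENT (`c_RE ∝ N^d`, from row NE3's mean-value∕ℓ²→sup step) — the
volume-free, k-uniform replacement is [B9] Thm 3.1 (3.42) for the scalar `G′(U)` + Thm 3.2 (3.48) (NOT proved, NOT asserted); nothing of Bałaban's asserted; (APE) on
curved data NOT proved; NOT ONE-STEP, NOT NE7; spine 0∕9; finite T⁴ rung (B)+1 — NOT infinite volume, NOT mass gap, NOT `BetaPertH`, NOT Clay.  Continuum YM on T⁴ ⇐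
BetaPertH ∧ nine spine estimates (0/9 proved); BetaPertH ⇐ (D1) ∧ (D4) ∧ CAP+tail; G-an2-4 gates asym, D1 and NE2/3/4.
-/

set_option autoImplicit false

open scoped BigOperators Matrix Matrix.Norms.L2Operator
open NormedSpace Finset

namespace Summit.QuantumFields.BalabanUV.T4Continuum.NE7LandauB8CorrectionRow

open Literature.MathematicalPhysics.QuantumFieldTheory.Balaban1983to89
open B7Prop1Explicit B7Prop2Explicit
open T4AveragingDeficitWall (Ad IsUnitaryCfg IsSkewDir SmallField covGrad flux Plane)
open T4AveragingDeficitWallBoundary (IsPeriodicCfg periodBox)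
open AveragingDeficitPeriodicCounting (IsPeriodicDir)
open AveragingDeficitMultiLevelPrep (LevelSmall)
open BlockAveragePushDirGauge (gaugeDir)
open NE3CovariantCalculus (hsR)
open NE3CovariantWeitzenbock (covDiv)
open NE3RightInverseSupLetters (frameC)
open NE3.PairLandauB8 (avgKernelGauges covLapSite IsLandauB8)
open NE3.LandauProjectionB8 (exists_landauB8_correction)
open NE3.LandauCorrectionSupB8Flat (sum_hsR_covDiv_add_covLapSite_eq_zero_of_isLandauB8)
open NE3.LandauProjectionSupCurvedUniform (hRW_of_radii)
open NE3.SupRegularityCurvedUniform (supRegularity_uniform)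
open NE3FluxGradientDictionary (norm_Ad_hol_sub_hol_le_of_fluxGrad)
open NE3CurvedCornerGaugeSpace (covDiv_mem_skewAdjoint)
open NE3LandauOrbit (covDiv_add_period)

noncomputable section

variable {d : ℕ} {n : Type*} [Fintype n] [DecidableEq n]

/-! ## §1 (R-C8) from the plaquette-gradient radius -/

/-- **THE (1.38)-LANDAU CORRECTION OF A GENERAL `Z`: EXISTENCE AND THREE SUP ROWS** (`d ≥ 1`, `L ≥ 2`, `N ≥ 1`, `j`; `M = L^{j+1}`, `F = frameC d L + d`,
`c_RE = 1 + 2·card n·(64d²N)^d + 27(card n)³512^dN^d`): for unitary `(N·M)`-periodic `W` with `LevelSmall d L j x`, `SmallField W x`, covariant plaquette gradients `≤ x₁`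
and the two level-free lines `23040d⁴F²M²x ≤ 1`, `11520d⁴F³M³x₁ ≤ 1`, every skew `(N·M)`-periodic `Z` with `‖covDiv_W Z‖_∞ ≤ D′` has a correction
`c ∈ N(Q′(W))` with `Z + D_W c` (1.38)-Landau (`IsLandauB8`), `‖Δ_W c‖ ≤ c_RE·D′`, `‖D_W c‖ ≤ 36dF·M·c_RE·D′`, `‖c‖ ≤ 36dF²·M²·c_RE·D′`. [folklore] -/
theorem landauB8Correction_row [Nonempty n] (hd : 1 ≤ d) {L N : ℕ} [NeZero N] (hL : 2 ≤ L) (j : ℕ)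
    {W : Site d → Fin d → (Matrix n n ℂ)ˣ} {x x₁ : ℝ} (hWu : IsUnitaryCfg W) (hWP : IsPeriodicCfg W ((N * L ^ (j + 1) : ℕ) : ℤ))
    (hx : 0 ≤ x) (hs : LevelSmall d L j x) (hWx : SmallField W x) (hx10 : 0 ≤ x₁)
    (hgrad : ∀ (p : Site d) (μ κ : Fin d), κ ≠ μ →
      ‖Ad (W p μ) ((hol W (p + e μ) (plaqWord κ μ) : (Matrix n n ℂ)ˣ) : Matrix n n ℂ) - ((hol W p (plaqWord κ μ) : (Matrix n n ℂ)ˣ) : Matrix n n ℂ)‖ ≤ x₁)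
    (hbx : 23040 * (d : ℝ) ^ 4 * (frameC d L + d) ^ 2 * ((L : ℝ) ^ (j + 1)) ^ 2 * x ≤ 1)
    (hcx : 11520 * (d : ℝ) ^ 4 * (frameC d L + d) ^ 3 * ((L : ℝ) ^ (j + 1)) ^ 3 * x₁ ≤ 1)
    {Z : Site d → Fin d → Matrix n n ℂ} (hZs : IsSkewDir Z) (hZP : IsPeriodicDir Z ((N * L ^ (j + 1) : ℕ) : ℤ))
    {D' : ℝ} (hD : ∀ y : Site d, ‖covDiv W Z y‖ ≤ D') :
    ∃ c ∈ avgKernelGauges (d := d) (n := n) L N (j + 1) W,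
      IsLandauB8 (d := d) L N (j + 1) W (fun y κ => Z y κ + gaugeDir W c y κ) ∧
      (∀ y : Site d, ‖covLapSite W c y‖
        ≤ (1 + 2 * (Fintype.card n : ℝ) * (64 * (d : ℝ) ^ 2 * N) ^ d + 27 * (Fintype.card n : ℝ) ^ 3 * (512 : ℝ) ^ d * (N : ℝ) ^ d) * D') ∧
      (∀ (y : Site d) (μ : Fin d), ‖gaugeDir W c y μ‖ ≤ 36 * d * (frameC d L + d) * (L : ℝ) ^ (j + 1)
        * ((1 + 2 * (Fintype.card n : ℝ) * (64 * (d : ℝ) ^ 2 * N) ^ d + 27 * (Fintype.card n : ℝ) ^ 3 * (512 : ℝ) ^ d * (N : ℝ) ^ d) * D')) ∧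
      (∀ y : Site d, ‖c y‖ ≤ 36 * d * (frameC d L + d) ^ 2 * ((L : ℝ) ^ (j + 1)) ^ 2
        * ((1 + 2 * (Fintype.card n : ℝ) * (64 * (d : ℝ) ^ 2 * N) ^ d + 27 * (Fintype.card n : ℝ) ^ 3 * (512 : ℝ) ^ d * (N : ℝ) ^ d) * D')) := by
  have hL1 : 1 ≤ L := by omega
  have hN : 1 ≤ N := Nat.one_le_iff_ne_zero.mpr (NeZero.ne N)
  have hP : 1 ≤ N * L ^ (j + 1) := Nat.mul_pos (by omega) (Nat.pow_pos (by omega))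
  -- existence (row NE3, Riesz on `N(Q′(W))`)
  obtain ⟨c, hc, hcL⟩ := exists_landauB8_correction hL1 hN j hWu hWP hx hs hWx Z
  -- the divergence source and the Euler–Lagrange form of (1.38)
  have hFs : ∀ y : Site d, covDiv W Z y ∈ skewAdjoint (Matrix n n ℂ) := fun y => covDiv_mem_skewAdjoint hWu hZs y
  have hFP : ∀ (y : Site d) (i : Fin d), covDiv W Z (y + ((N * L ^ (j + 1) : ℕ) : ℤ) • e i) = covDiv W Z y :=
    covDiv_add_period hWP hZP
  have hEL : ∀ ν ∈ avgKernelGauges (d := d) (n := n) L N (j + 1) W,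
      ∑ y ∈ periodBox (d := d) (N * L ^ (j + 1)), hsR (covDiv W Z y + covLapSite W c y) (covLapSite W ν y) = 0 :=
    fun ν hν => sum_hsR_covDiv_add_covLapSite_eq_zero_of_isLandauB8 hP hWu hWP hZP hc.2.1 hcL hν
  -- (HR_W): the sup of `Δ_W c`
  have hΔ : ∀ y : Site d, ‖covLapSite W c y‖
      ≤ (1 + 2 * (Fintype.card n : ℝ) * (64 * (d : ℝ) ^ 2 * N) ^ d + 27 * (Fintype.card n : ℝ) ^ 3 * (512 : ℝ) ^ d * (N : ℝ) ^ d) * D' :=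
    hRW_of_radii hd hL j hWu hWP hx hs hWx hx10 hgrad hbx hcx (covDiv W Z) hFs hFP c hc hEL D' hD
  -- (H0_W): sup regularity of `Δ_W` on `N(Q′(W))`
  obtain ⟨hDc, hUc⟩ := supRegularity_uniform hd hL j hWu hWP hx hs hWx hx10 hgrad hbx hcx hc hΔ
  exact ⟨c, hc, hcL, hΔ, hDc, hUc⟩

/-! ## §2 (R-C8) from the flux-gradient radius (the END's letters) -/

/-- **(R-C8) FROM THE END's CLASS DATA OF `W`** (`d ≥ 1`, `L ≥ 2`, `N ≥ 1`, `j`): `SmallField W x` with `x ≤ 1∕4`, the flux-gradient radius `‖covGrad W (flux W)‖ ≤ g_W` (`g_W ≥ 0`)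
and the END's two level-free lines `23040d⁴F²M²x ≤ 1`, `11520d⁴F³M³(2g_W) ≤ 1` give §1's conclusion (`x₁ = 2g_W` by `NE3FluxGradientDictionary`). [folklore] -/
theorem landauB8Correction_row_of_fluxGrad [Nonempty n] (hd : 1 ≤ d) {L N : ℕ} [NeZero N] (hL : 2 ≤ L) (j : ℕ)
    {W : Site d → Fin d → (Matrix n n ℂ)ˣ} {x gW : ℝ} (hWu : IsUnitaryCfg W) (hWP : IsPeriodicCfg W ((N * L ^ (j + 1) : ℕ) : ℤ))
    (hx : 0 ≤ x) (hx4 : x ≤ 1 / 4) (hs : LevelSmall d L j x) (hWx : SmallField W x) (hgW0 : 0 ≤ gW)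
    (hgW : ∀ (z : Site d) (μ : Fin d) (π : Plane d), ‖covGrad W (flux W) z μ π‖ ≤ gW)
    (hbx : 23040 * (d : ℝ) ^ 4 * (frameC d L + d) ^ 2 * ((L : ℝ) ^ (j + 1)) ^ 2 * x ≤ 1)
    (hcx : 11520 * (d : ℝ) ^ 4 * (frameC d L + d) ^ 3 * ((L : ℝ) ^ (j + 1)) ^ 3 * (2 * gW) ≤ 1)
    {Z : Site d → Fin d → Matrix n n ℂ} (hZs : IsSkewDir Z) (hZP : IsPeriodicDir Z ((N * L ^ (j + 1) : ℕ) : ℤ))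
    {D' : ℝ} (hD : ∀ y : Site d, ‖covDiv W Z y‖ ≤ D') :
    ∃ c ∈ avgKernelGauges (d := d) (n := n) L N (j + 1) W,
      IsLandauB8 (d := d) L N (j + 1) W (fun y κ => Z y κ + gaugeDir W c y κ) ∧
      (∀ y : Site d, ‖covLapSite W c y‖
        ≤ (1 + 2 * (Fintype.card n : ℝ) * (64 * (d : ℝ) ^ 2 * N) ^ d + 27 * (Fintype.card n : ℝ) ^ 3 * (512 : ℝ) ^ d * (N : ℝ) ^ d) * D') ∧
      (∀ (y : Site d) (μ : Fin d), ‖gaugeDir W c y μ‖ ≤ 36 * d * (frameC d L + d) * (L : ℝ) ^ (j + 1)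
        * ((1 + 2 * (Fintype.card n : ℝ) * (64 * (d : ℝ) ^ 2 * N) ^ d + 27 * (Fintype.card n : ℝ) ^ 3 * (512 : ℝ) ^ d * (N : ℝ) ^ d) * D')) ∧
      (∀ y : Site d, ‖c y‖ ≤ 36 * d * (frameC d L + d) ^ 2 * ((L : ℝ) ^ (j + 1)) ^ 2
        * ((1 + 2 * (Fintype.card n : ℝ) * (64 * (d : ℝ) ^ 2 * N) ^ d + 27 * (Fintype.card n : ℝ) ^ 3 * (512 : ℝ) ^ d * (N : ℝ) ^ d) * D')) := by
  have hgrad : ∀ (p : Site d) (μ κ : Fin d), κ ≠ μ →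
      ‖Ad (W p μ) ((hol W (p + e μ) (plaqWord κ μ) : (Matrix n n ℂ)ˣ) : Matrix n n ℂ) - ((hol W p (plaqWord κ μ) : (Matrix n n ℂ)ˣ) : Matrix n n ℂ)‖ ≤ 2 * gW :=
    fun p μ κ hκμ => norm_Ad_hol_sub_hol_le_of_fluxGrad hWu hWx hx4 hgW p μ hκμ
  exact landauB8Correction_row hd hL j hWu hWP hx hs hWx (by positivity) hgrad hbx hcx hZs hZP hD

/-! ## §3 The END's binder `hRC`, literally -/

/-- **THE END's (R-C8) LETTER `hRC` OF `NE7ApeCurvedRepRoadBLandauB8End` WITH `C_b := 36d·F²·M²·c_RE`, AS A THEOREM** (same data as §2). [folklore] -/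
theorem landauB8CorrectionLetter_of_fluxGrad [Nonempty n] (hd : 1 ≤ d) {L N : ℕ} [NeZero N] (hL : 2 ≤ L) (j : ℕ)
    {W : Site d → Fin d → (Matrix n n ℂ)ˣ} {x gW : ℝ} (hWu : IsUnitaryCfg W) (hWP : IsPeriodicCfg W ((N * L ^ (j + 1) : ℕ) : ℤ))
    (hx : 0 ≤ x) (hx4 : x ≤ 1 / 4) (hs : LevelSmall d L j x) (hWx : SmallField W x) (hgW0 : 0 ≤ gW)
    (hgW : ∀ (z : Site d) (μ : Fin d) (π : Plane d), ‖covGrad W (flux W) z μ π‖ ≤ gW)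
    (hbx : 23040 * (d : ℝ) ^ 4 * (frameC d L + d) ^ 2 * ((L : ℝ) ^ (j + 1)) ^ 2 * x ≤ 1)
    (hcx : 11520 * (d : ℝ) ^ 4 * (frameC d L + d) ^ 3 * ((L : ℝ) ^ (j + 1)) ^ 3 * (2 * gW) ≤ 1)
    {cRE : ℝ} (hcRE : cRE = 1 + 2 * (Fintype.card n : ℝ) * (64 * (d : ℝ) ^ 2 * N) ^ d + 27 * (Fintype.card n : ℝ) ^ 3 * (512 : ℝ) ^ d * (N : ℝ) ^ d) :
    ∀ Z : Site d → Fin d → Matrix n n ℂ, IsSkewDir Z → IsPeriodicDir Z ((N * L ^ (j + 1) : ℕ) : ℤ) →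
      ∀ D' : ℝ, (∀ y, ‖covDiv W Z y‖ ≤ D') →
      ∃ c ∈ avgKernelGauges (d := d) (n := n) L N (j + 1) W,
        IsLandauB8 (d := d) L N (j + 1) W (fun y κ => Z y κ + gaugeDir W c y κ) ∧
        ∀ y, ‖c y‖ ≤ (36 * d * (frameC d L + d) ^ 2 * ((L : ℝ) ^ (j + 1)) ^ 2 * cRE) * D' := by
  intro Z hZs hZP D' hD
  obtain ⟨c, hc, hcL, -, -, hUc⟩ := landauB8Correction_row_of_fluxGrad hd hL j hWu hWP hx hx4 hs hWx hgW0 hgW hbx hcx hZs hZP hD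
  refine ⟨c, hc, hcL, fun y => (hUc y).trans (le_of_eq ?_)⟩
  rw [hcRE]; ring

end

end Summit.QuantumFields.BalabanUV.T4Continuum.NE7LandauB8CorrectionRow
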